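import Literature.Geometry.Kaehler.ComplexTorusMaps
import Literature.Geometry.Kaehler.ComplexTorusOfComplexStructure
import Literature.NumberTheory.Transcendental.Analytification
import HarnessLib

/-!
# Route `SecondaryPeriods` — crux `RiemannWeightOne` (stmt-HodgeConjecture-16406), line `birth`: stub `stub_transfer`

The registered stub `stub_transfer` of the line skeleton
`Summits/HodgeConjecture/HodgeConjecture/Cruxes/RiemannWeightOne/Lines/birth.lean`, proved
unconditionally: **invariance of `IsAnalytification` under a change of period isomorphism with
`ℂ`-linear transition.**

**Statement.** Let `Φ, Φ' : ℝ^ι ≃ ℂⁿ` be two period isomorphisms of the same lattice `ℤ^ι` whose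
transition `Φ ∘ Φ'⁻¹ : ℂⁿ → ℂⁿ` commutes with multiplication by `i` (i.e. is `ℂ`-linear). The complex
tori `ComplexTorus Φ` and `ComplexTorus Φ'` are the same topological group `(ℝ/ℤ)^ι` with two complex
structures, and if `φ : ComplexTorus Φ → X(ℂ)` is an analytification of the `ℂ`-scheme `X`, so is the
same map read on `ComplexTorus Φ'`.

**Proof.** The identity `(ℝ/ℤ)^ι → (ℝ/ℤ)^ι`, seen as a map `ComplexTorus Φ' → ComplexTorus Φ`, lifts to
the universal covers as `Φ ∘ Φ'⁻¹`, which is `ℂ`-linear, hence holomorphic; so the identity is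
holomorphic (`ComplexTorus.contMDiff_of_lift`, Lange–Birkenhake (1992), §1.1.2: maps of tori are
studied through their `ℂ`-linear lifts), and pulled-back regular functions, holomorphic on
`ComplexTorus Φ`, stay holomorphic on `ComplexTorus Φ'` by the chain rule. The homeomorphism and
dimension clauses are untouched (same topology, same model space).

## References

* [LangeBirkenhake1992] H. Lange, Ch. Birkenhake, Complex Abelian Varieties, Grundlehren 302 (1992),
  §1.1.2 (homomorphisms of complex tori and their analytic representations).
-/

noncomputable section

-- every declaration of this problem lives in `Summit.HodgeConjecture.HodgeConjecture.…`
set_option linter.dupNamespace false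

namespace Summit.HodgeConjecture.HodgeConjecture.Theorems.RiemannWeightOne

open scoped TensorProduct Manifold ContDiff
open CategoryTheory AlgebraicGeometry
open Literature.AlgebraicGeometry.Motives
open Literature.Geometry.Kaehler (ComplexTorus CxModule IsAnalyticSet toComplexLinear)
open Literature.NumberTheory.Transcendental (IsAnalytification IsProjAlgebraicSet)

/-- **The identity between two presentations of a complex torus with `ℂ`-linear transition is
holomorphic.** If `Φ, Φ' : ℝ^ι ≃ E` are period isomorphisms with `Φ ∘ Φ'⁻¹` commuting with `i`, then
the identity of `(ℝ/ℤ)^ι`, as a map `ComplexTorus Φ' → ComplexTorus Φ`, is `C^n` over `ℂ` for every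
`n` (its lift to the universal covers is the `ℂ`-linear map `Φ ∘ Φ'⁻¹`). Lange–Birkenhake (1992),
§1.1.2. [cite: LangeBirkenhake1992, §1.1.2] -/
theorem contMDiff_id_of_transition {ι : Type*} [Fintype ι] {E : Type*} [NormedAddCommGroup E]
    [NormedSpace ℂ E] (Φ Φ' : (ι → ℝ) ≃L[ℝ] E)
    (hI : ∀ u, Φ (Φ'.symm (Complex.I • u)) = Complex.I • Φ (Φ'.symm u)) {n : WithTop ℕ∞} :
    ContMDiff 𝓘(ℂ, E) 𝓘(ℂ, E) n (fun t : ComplexTorus Φ' => (id t : ComplexTorus Φ)) := by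
  -- the transition `Φ ∘ Φ'⁻¹`, a continuous real-linear map commuting with `i`, hence `ℂ`-linear
  set G : E →L[ℝ] E := (Φ : (ι → ℝ) →L[ℝ] E).comp (Φ'.symm : E →L[ℝ] (ι → ℝ)) with hG_def
  have hG : ∀ u, G (Complex.I • u) = Complex.I • G u := fun u => by
    simp only [hG_def, ContinuousLinearMap.coe_comp, Function.comp_apply,
      ContinuousLinearEquiv.coe_coe]
    exact hI u
  refine Literature.Geometry.Kaehler.ComplexTorus.contMDiff_of_lift (G := toComplexLinear G hG)
    (toComplexLinear G hG).contDiff fun z => ?_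
  change Literature.Geometry.Kaehler.ComplexTorus.proj Φ' (Φ'.symm z) =
    Literature.Geometry.Kaehler.ComplexTorus.proj Φ (Φ.symm (Φ (Φ'.symm z)))
  rw [ContinuousLinearEquiv.symm_apply_apply]
  rfl

/-- **Invariance of `IsAnalytification` under a change of period isomorphism with `ℂ`-linear
transition** (the registered stub `stub_transfer` of the line `birth`, verbatim). `ComplexTorus Φ`
and `ComplexTorus Φ'` are the same topological space `(ℝ/ℤ)^ι`; when `Φ ∘ Φ'⁻¹` is `ℂ`-linear the
identity `ComplexTorus Φ' → ComplexTorus Φ` is holomorphic (its lift to the universal covers is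
`Φ ∘ Φ'⁻¹`), so the pull-back of a regular function, holomorphic on `ComplexTorus Φ`, is holomorphic
on `ComplexTorus Φ'`. Lange–Birkenhake (1992), §1.1.2. [cite: LangeBirkenhake1992, §1.1.2] -/
theorem stub_transfer :
    ∀ ⦃ι : Type⦄ [Fintype ι] ⦃n : ℕ⦄ (Φ Φ' : (ι → ℝ) ≃L[ℝ] (Fin n → ℂ)),
      (∀ u, Φ (Φ'.symm (Complex.I • u)) = Complex.I • Φ (Φ'.symm u)) →
      ∀ ⦃X : SchemeOver ℂ⦄ (φ : ComplexTorus Φ → ComplexPoints X),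
        IsAnalytification (Fin n → ℂ) X n φ →
        IsAnalytification (Fin n → ℂ) X n (fun t : ComplexTorus Φ' => φ t) := by
  intro ι _ n Φ Φ' hI X φ hφ
  -- the identity `ComplexTorus Φ' → ComplexTorus Φ` is holomorphic, hence `MDifferentiable`
  have he : MDifferentiable 𝓘(ℂ, Fin n → ℂ) 𝓘(ℂ, Fin n → ℂ)
      (fun t : ComplexTorus Φ' => (id t : ComplexTorus Φ)) :=
    (contMDiff_id_of_transition Φ Φ' hI (n := 1)).mdifferentiable one_ne_zero
  refine ⟨?_, hφ.finrank_eq, fun U s => ?_⟩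
  · -- same underlying topological space
    exact hφ.isHomeomorph
  · -- chain rule: `(s ∘ φ) ∘ id` with `s ∘ φ` holomorphic on `ComplexTorus Φ` and `id` holomorphic
    exact (hφ.mdifferentiableOn_evalOrZero U s).comp he.mdifferentiableOn fun t ht => ht

end Summit.HodgeConjecture.HodgeConjecture.Theorems.RiemannWeightOne

end
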